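import Mathlib
import Literature.Computability.AlgebraicComplexity.NewtonPolygonTauTransfer
import Literature.Computability.AlgebraicComplexity.NewtonPolygonTauProductBounds
import Literature.Computability.AlgebraicComplexity.DepthThreeChasmGKKSProofs
import HarnessLib

/-!
# KPTT 2015, Theorem 3: sums of powers of sparse polynomials suffice (weak-form instance)

P. Koiran, N. Portier, S. Tavenas, S. Thomassé, *A τ-conjecture for Newton polygons*, Found.
Comput. Math. 15 (2015) 185–197 (arXiv:1308.2286), §3 "Proof of Theorem 1, and a Refinement"
(held text, pp. 5–6): "We show that it suffices to bound the number of edges of the Newton polygons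
of sums of powers of sparse polynomials in order to obtain a lower bound for the permanent."

* Theorem 3 (printed): fix `c < 2` and assume the bound `2^{(m + log kt)^c}` on the number of edges
  of `Newt(f)` for `f = Σ_{i=1}^k a_i f_i(X,Y)^m`, `a_i ∈ 𝕂`, `f_i` with at most `t` monomials
  (for `kmt` large); then the permanent is not computable by polynomial-size arithmetic circuits.
  Proof: Fischer's formula (Lemma 1) rewrites each of the `k` products of (1) as a linear
  combination of `2^{m-1}` `m`-th powers of polynomials with at most `mt` monomials, so the
  hypothesis of Theorem 3 implies that of Theorem 1. "Clearly, we can assume that all the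
  coefficients `a_i` are equal to 1 (multiply `f_i` by a `m`-th root of `a_i` if necessary)."

Held text (arXiv:1308.2286): Theorem 3 = p0005:L92–L102, "Clearly, we can assume … `a_i` … equal
to 1" = p0005:L104–L106, Lemma 1 (Fischer's formula) = p0005:L114–L119, proof of Theorem 3 =
p0005:L126–p0006:L8, Remark 2 (characteristic `0` matters) = p0006:L9–L13. With this file KPTT's
Theorem 3 is recorded in the tree (the module docstring of `NewtonPolygonTau.lean` lists
"Thms 2–3" as not recorded; Theorem 2 is the depth-four reduction of `DepthReduction*.lean`).

As for Theorem 1 (`KPTT.theorem1`, `KPTT.theorem1_holds` in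
`NewtonPolygonTauTransfer.lean`), the tree records the WEAK-FORM INSTANCE over `ℂ`: the hypothesis
is a bound `2^{a·m}·(kt + 2)^b` (the "for instance" form singled out after Theorem 1, p0004:L111),
the conclusion is `¬ IsVPFamily (per_n)`. KPTT THEOREM 3'S HYPOTHESIS (the powers bound) IS OPEN —
like `newtonTauWeak` it is posed, never asserted, by KPTT; NOTHING HERE ASSERTS IT: it is an
inlined binder of the theorems below, and no named fact / `def … : Prop` is introduced:

* `KPTT.prod_eq_sum_powerset_pow`, `KPTT.sum_prod_eq_sum_powers` — Fischer's formula in the Ryser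
  form of the tree (`DepthThreeChasm.fischer_ryser`, `2^m` powers instead of the printed `2^{m-1}`,
  immaterial for the weak form): `Σ_{i<k} Π_{j<m} f_ij = Σ_{(i,S)} C((m!)⁻¹ (-1)^{m-|S|}) · (Σ_{j∈S} f_ij)^m`;
* `KPTT.card_support_finset_sum_le` — `Σ_{j∈S} f_ij` has at most `m·t` monomials;
* `KPTT.newtonTauWeak_of_powersBound` — a bound `2^{am}(kt+2)^b` for all sums
  `Σ_{i<k} C(c_i)·g_i^m` of `m`-th powers of `t`-sparse polynomials gives `newtonTauWeak` with
  constants `(a + 2b, b)`;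
* `KPTT.newtonTauWeak_of_purePowersBound` — the same from the coefficient-free hypothesis
  (`Σ_{i<k} g_i^m`), by `m`-th roots in `ℂ`;
* `KPTT.powersBound_of_newtonTauWeak`, `KPTT.newtonTauWeak_iff_powersBound` — conversely sums of
  powers are sums of products, so in the weak form the two hypotheses are EQUIVALENT (up to the
  constants); both remain open;
* `KPTT.not_isVPFamily_per_of_powersBound`, `KPTT.not_isVPFamily_per_of_purePowersBound` —
  Theorem 3 (weak-form instance): the two transfers to `¬ IsVPFamily (per_n)`, by the tree's
  `theorem1_holds` (used by name, not restated).

-- TODO(general form): the printed hypothesis `2^{(m + log kt)^c}`, `c < 2`, "for `kmt`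
-- sufficiently large" (also for Theorem 1) is not recorded; only the weak-form instance is.

## References

* P. Koiran, N. Portier, S. Tavenas, S. Thomassé, Found. Comput. Math. 15 (2015) 185–197,
  arXiv:1308.2286: Theorem 3, Lemma 1 (Fischer's formula), proof of Theorem 3 and Remark 2 (§3)
  [KoiranPortierTavenasThomasse2015].
* A. Gupta, P. Kamath, N. Kayal, R. Saptharishi, SIAM J. Comput. 45 (2016), Lemma 4.3 (Fischer's
  identity, Ryser form; tree `DepthThreeChasm.fischer_ryser`) [GuptaKamathKayalSaptharishi2016].
-/

noncomputable section

open Finset MvPolynomial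

namespace Literature.Computability.AlgebraicComplexity

namespace KPTT

/-! ### Fischer's formula for a product of polynomials -/

/-- **Fischer's formula** (KPTT Lemma 1, in the Ryser form `m! z_1 ⋯ z_m =
Σ_{S ⊆ [m]} (-1)^{m-|S|} (Σ_{j∈S} z_j)^m` of the tree's `DepthThreeChasm.fischer_ryser`), solved for
the product over `ℂ`: a product of `m` polynomials is a linear combination of the `2^m` `m`-th
powers `(Σ_{j ∈ S} f_j)^m`. [cite: KoiranPortierTavenasThomasse2015, Lemma 1 (§3; held text p0005:L114–L119)] -/
theorem prod_eq_sum_powerset_pow {σ : Type*} (m : ℕ) (f : Fin m → MvPolynomial σ ℂ) :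
    ∏ j, f j = ∑ S : Finset (Fin m), C (((m.factorial : ℂ))⁻¹ * (-1) ^ (m - S.card)) * (∑ j ∈ S, f j) ^ m := by
  have hF := DepthThreeChasm.fischer_ryser f (Finset.univ : Finset (Fin m))
  rw [Finset.card_univ, Fintype.card_fin, Finset.powerset_univ] at hF
  have hne : ((m.factorial : ℂ)) ≠ 0 := Nat.cast_ne_zero.2 (Nat.factorial_ne_zero m)
  have hcast : ((m.factorial : ℕ) : MvPolynomial σ ℂ) = C ((m.factorial : ℂ)) :=
    (map_natCast (C : ℂ →+* MvPolynomial σ ℂ) _).symm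
  calc ∏ j, f j = C (((m.factorial : ℂ))⁻¹) * (((m.factorial : ℕ) : MvPolynomial σ ℂ) * ∏ j, f j) := by
          rw [hcast, ← mul_assoc, ← C_mul, inv_mul_cancel₀ hne, C_1, one_mul]
    _ = ∑ S : Finset (Fin m), C (((m.factorial : ℂ))⁻¹ * (-1) ^ (m - S.card)) * (∑ j ∈ S, f j) ^ m := by
          rw [hF, Finset.mul_sum]
          refine Finset.sum_congr rfl fun S _ => ?_
          rw [C_mul, C_pow, C_neg, C_1]
          ring

/-- **Sums of products are sums of powers** (proof of KPTT Theorem 3): `Σ_{i<k} Π_{j<m} f_ij` is the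
sum over the `k·2^m` pairs `(i, S)` of `C((m!)⁻¹(-1)^{m-|S|}) · (Σ_{j∈S} f_ij)^m`.
[cite: KoiranPortierTavenasThomasse2015, proof of Thm. 3 (§3; held text p0005:L126–L133)] -/
theorem sum_prod_eq_sum_powers {σ : Type*} (k m : ℕ) (f : Fin k → Fin m → MvPolynomial σ ℂ) :
    ∑ i, ∏ j, f i j =
      ∑ p : Fin k × Finset (Fin m), C (((m.factorial : ℂ))⁻¹ * (-1) ^ (m - p.2.card)) * (∑ j ∈ p.2, f p.1 j) ^ m := by
  rw [Fintype.sum_prod_type]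
  exact Finset.sum_congr rfl fun i _ => prod_eq_sum_powerset_pow m (f i)

/-- A sum of `|S|` polynomials with at most `t` monomials each has at most `|S|·t` monomials
("the `f_i` have at most `mt` monomials").
[cite: KoiranPortierTavenasThomasse2015, proof of Thm. 3 (§3; held text p0005:L132)] -/
theorem card_support_finset_sum_le {σ R ι : Type*} [CommSemiring R] (S : Finset ι)
    (g : ι → MvPolynomial σ R) (t : ℕ) (hg : ∀ j ∈ S, (g j).support.card ≤ t) :
    (∑ j ∈ S, g j).support.card ≤ S.card * t := by
  classical
  calc (∑ j ∈ S, g j).support.card ≤ (S.biUnion fun j => (g j).support).card :=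
        Finset.card_le_card (MvPolynomial.support_sum)
    _ ≤ ∑ j ∈ S, (g j).support.card := Finset.card_biUnion_le
    _ ≤ ∑ _j ∈ S, t := Finset.sum_le_sum hg
    _ = S.card * t := by rw [Finset.sum_const, smul_eq_mul]

/-- The number of `(i, S)` pairs: `|Fin k × Finset (Fin m)| = k · 2^m`. [folklore] -/
private theorem card_prod_finset (k m : ℕ) : Fintype.card (Fin k × Finset (Fin m)) = k * 2 ^ m := by
  rw [Fintype.card_prod, Fintype.card_fin, Fintype.card_finset, Fintype.card_fin]

/-- Arithmetic of the transfer: `2^{am}·(k·2^m·(mt) + 2)^b ≤ 2^{(a+2b)m}·(kt + 2)^b`. [folklore] -/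
private theorem powers_bound_arith (a b k m t : ℕ) :
    2 ^ (a * m) * (k * 2 ^ m * (m * t) + 2) ^ b ≤ 2 ^ ((a + 2 * b) * m) * (k * t + 2) ^ b := by
  have hm : m + 1 ≤ 2 ^ m := Nat.succ_le_of_lt (Nat.lt_two_pow_self)
  have h1 : k * 2 ^ m * (m * t) + 2 ≤ 4 ^ m * (k * t + 2) := by
    have h2 : k * 2 ^ m * (m * t) + 2 ≤ 2 ^ m * (m + 1) * (k * t + 2) := by
      have : 1 ≤ 2 ^ m := Nat.one_le_two_pow
      nlinarith [Nat.zero_le (k * t), Nat.zero_le m, this]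
    calc k * 2 ^ m * (m * t) + 2 ≤ 2 ^ m * (m + 1) * (k * t + 2) := h2
      _ ≤ 2 ^ m * 2 ^ m * (k * t + 2) := by gcongr
      _ = 4 ^ m * (k * t + 2) := by
          rw [← pow_add, show (4 : ℕ) = 2 ^ 2 by norm_num, ← pow_mul]; ring_nf
  calc 2 ^ (a * m) * (k * 2 ^ m * (m * t) + 2) ^ b
      ≤ 2 ^ (a * m) * (4 ^ m * (k * t + 2)) ^ b := by gcongr
    _ = 2 ^ ((a + 2 * b) * m) * (k * t + 2) ^ b := by
          rw [mul_pow, show (4 : ℕ) ^ m = 2 ^ (2 * m) by rw [pow_mul]; norm_num]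
          ring

/-! ### Theorem 3, weak-form instance -/

/-- **The hypothesis of KPTT Theorem 3 implies that of Theorem 1 (weak forms)**: IF every sum of
`m`-th powers `Σ_{i<k} c_i·g_i^m` of `t`-sparse bivariate polynomials over `ℂ` has a Newton polygon
with at most `2^{am}(kt + 2)^b` vertices (an OPEN hypothesis; nothing here asserts it), then the
weak Newton-polygon τ-bound `newtonTauWeak` holds (with constants `a + 2b`, `b`): by Fischer's
formula a sum of `k` products of `m` `t`-sparse polynomials is a sum of `k·2^m` `m`-th powers of
`mt`-sparse polynomials. [cite: KoiranPortierTavenasThomasse2015, Thm. 3 and its proof (§3; held text p0005:L92–L102, p0005:L126–p0006:L8)] -/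
theorem newtonTauWeak_of_powersBound
    (h : ∃ a b : ℕ, ∀ (k m t : ℕ) (c : Fin k → ℂ) (g : Fin k → MvPolynomial (Fin 2) ℂ),
      (∀ i, (g i).support.card ≤ t) →
        newtonVertexCount (∑ i, C (c i) * g i ^ m) ≤ 2 ^ (a * m) * (k * t + 2) ^ b) :
    newtonTauWeak := by
  obtain ⟨a, b, hab⟩ := h
  refine ⟨a + 2 * b, b, fun k m t f hf => ?_⟩
  classical
  -- reindex the `(i, S)` pairs by `Fin (k * 2^m)`
  let e : Fin k × Finset (Fin m) ≃ Fin (k * 2 ^ m) :=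
    Fintype.equivFinOfCardEq (card_prod_finset k m)
  let g : Fin (k * 2 ^ m) → MvPolynomial (Fin 2) ℂ := fun l => ∑ j ∈ (e.symm l).2, f (e.symm l).1 j
  let c : Fin (k * 2 ^ m) → ℂ := fun l => ((m.factorial : ℂ))⁻¹ * (-1) ^ (m - (e.symm l).2.card)
  have hsum : ∑ i, ∏ j, f i j = ∑ l, C (c l) * g l ^ m := by
    rw [sum_prod_eq_sum_powers k m f]
    exact (e.sum_comp (fun l => C (c l) * g l ^ m)).symm.trans (by simp [c, g]) |>.symm
  have hg : ∀ l, (g l).support.card ≤ m * t := fun l => by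
    refine (card_support_finset_sum_le _ _ t fun j _ => hf _ j).trans ?_
    exact Nat.mul_le_mul_right t ((Finset.card_le_univ _).trans (Fintype.card_fin m).le)
  have hcount := hab (k * 2 ^ m) m (m * t) c g hg
  rw [← hsum] at hcount
  exact hcount.trans (powers_bound_arith a b k m t)

/-- The coefficient-free hypothesis suffices ("Clearly, we can assume that all the coefficients
`a_i` are equal to 1 (multiply `f_i` by a `m`-th root of `a_i` if necessary)"): a bound
`2^{am}(kt+2)^b` for all pure sums of `m`-th powers `Σ_{i<k} g_i^m` of `t`-sparse polynomials gives
the same bound for `Σ_{i<k} c_i·g_i^m` (over `ℂ`: `c_i = r_i^m`, `c_i g_i^m = (r_i g_i)^m`; `m = 0`: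
a constant has at most one vertex). The lemma form of this printed sentence is ours. [folklore]
[cite: KoiranPortierTavenasThomasse2015, sentence after Thm. 3 (§3; held text p0005:L104–L106)] -/
theorem powersBound_of_purePowersBound {a b : ℕ}
    (h : ∀ (k m t : ℕ) (g : Fin k → MvPolynomial (Fin 2) ℂ), (∀ i, (g i).support.card ≤ t) →
      newtonVertexCount (∑ i, g i ^ m) ≤ 2 ^ (a * m) * (k * t + 2) ^ b)
    (k m t : ℕ) (c : Fin k → ℂ) (g : Fin k → MvPolynomial (Fin 2) ℂ)
    (hg : ∀ i, (g i).support.card ≤ t) :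
    newtonVertexCount (∑ i, C (c i) * g i ^ m) ≤ 2 ^ (a * m) * (k * t + 2) ^ b := by
  rcases Nat.eq_zero_or_pos m with rfl | hm
  · -- `m = 0`: the sum is a constant, at most one vertex
    have hconst : ∑ i, C (c i) * g i ^ 0 = C (∑ i, c i) := by simp [map_sum]
    rw [hconst]
    calc newtonVertexCount (C (∑ i, c i)) ≤ (C (∑ i, c i) : MvPolynomial (Fin 2) ℂ).support.card :=
          newtonVertexCount_le_card_support _
      _ ≤ 1 := by
          rw [MvPolynomial.C_apply, MvPolynomial.support_monomial]
          split_ifs <;> simp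
      _ ≤ 2 ^ (a * 0) * (k * t + 2) ^ b := by
          rw [mul_zero, pow_zero, one_mul]; exact Nat.one_le_pow _ _ (by omega)
  · -- `m ≥ 1`: absorb `c_i = r_i^m` into `g_i`
    have hr : ∀ i, ∃ r : ℂ, r ^ m = c i := fun i => IsAlgClosed.exists_pow_nat_eq (c i) hm
    choose r hr using hr
    have heq : ∑ i, C (c i) * g i ^ m = ∑ i, (C (r i) * g i) ^ m := by
      refine Finset.sum_congr rfl fun i _ => ?_
      rw [mul_pow, ← C_pow, hr]
    rw [heq]
    refine h k m t (fun i => C (r i) * g i) fun i => (Finset.card_le_card ?_).trans (hg i)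
    intro x hx
    rw [MvPolynomial.mem_support_iff] at hx ⊢
    rw [MvPolynomial.coeff_C_mul] at hx
    exact fun h0 => hx (by rw [h0, mul_zero])

/-- IF the coefficient-free powers bound holds (an OPEN hypothesis; nothing here asserts it), then
`newtonTauWeak` holds (constants `a + 2b`, `b`).
[cite: KoiranPortierTavenasThomasse2015, Thm. 3 and the sentence after it (§3; held text p0005:L92–L106)] -/
theorem newtonTauWeak_of_purePowersBound
    (h : ∃ a b : ℕ, ∀ (k m t : ℕ) (g : Fin k → MvPolynomial (Fin 2) ℂ),
      (∀ i, (g i).support.card ≤ t) →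
        newtonVertexCount (∑ i, g i ^ m) ≤ 2 ^ (a * m) * (k * t + 2) ^ b) :
    newtonTauWeak := by
  obtain ⟨a, b, hab⟩ := h
  exact newtonTauWeak_of_powersBound ⟨a, b, fun k m t c g hg =>
    powersBound_of_purePowersBound hab k m t c g hg⟩


/-! ### The converse: sums of powers are sums of products -/

/-- Support of `C c * g` is contained in the support of `g`. [folklore] -/
private theorem card_support_C_mul_le {σ : Type*} (c : ℂ) (g : MvPolynomial σ ℂ) :
    (C c * g).support.card ≤ g.support.card := by
  classical
  refine Finset.card_le_card fun x hx => ?_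
  rw [MvPolynomial.mem_support_iff] at hx ⊢
  rw [MvPolynomial.coeff_C_mul] at hx
  exact fun h0 => hx (by rw [h0, mul_zero])

/-- **Sums of `m`-th powers are sums of `m`-fold products** (form (1) of KPTT with
`f_{i1} = a_i f_i`, `f_{ij} = f_i`): the weak bound `newtonTauWeak` gives the powers bound of
Theorem 3 with the same constants, so that — in the weak form — the hypothesis of Theorem 3 is
EQUIVALENT to that of Theorem 1 (`newtonTauWeak_iff_powersBound`); both remain OPEN.
[cite: KoiranPortierTavenasThomasse2015, Thm. 3 vs. form (1) (§2–§3; held text p0005:L92–L102)] -/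
theorem powersBound_of_newtonTauWeak (h : newtonTauWeak) :
    ∃ a b : ℕ, ∀ (k m t : ℕ) (c : Fin k → ℂ) (g : Fin k → MvPolynomial (Fin 2) ℂ),
      (∀ i, (g i).support.card ≤ t) →
        newtonVertexCount (∑ i, C (c i) * g i ^ m) ≤ 2 ^ (a * m) * (k * t + 2) ^ b := by
  obtain ⟨a, b, hab⟩ := h
  refine ⟨a, b, fun k m t c g hg => ?_⟩
  cases m with
  | zero =>
    -- `m = 0`: a constant, at most one vertex
    have hconst : ∑ i, C (c i) * g i ^ 0 = C (∑ i, c i) := by simp [map_sum]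
    rw [hconst]
    calc newtonVertexCount (C (∑ i, c i)) ≤ (C (∑ i, c i) : MvPolynomial (Fin 2) ℂ).support.card :=
          newtonVertexCount_le_card_support _
      _ ≤ 1 := by
          rw [MvPolynomial.C_apply, MvPolynomial.support_monomial]
          split_ifs <;> simp
      _ ≤ 2 ^ (a * 0) * (k * t + 2) ^ b := by
          rw [mul_zero, pow_zero, one_mul]; exact Nat.one_le_pow _ _ (by omega)
  | succ n =>
    -- `m = n + 1`: `c_i g_i^{n+1} = (c_i g_i) · g_i ⋯ g_i`
    let f : Fin k → Fin (n + 1) → MvPolynomial (Fin 2) ℂ :=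
      fun i j => if j = 0 then C (c i) * g i else g i
    have hf : ∀ i j, (f i j).support.card ≤ t := fun i j => by
      by_cases hj : j = 0
      · simp only [f, hj, if_true]; exact (card_support_C_mul_le _ _).trans (hg i)
      · simp only [f, hj, if_false]; exact hg i
    have hprod : ∀ i, ∏ j, f i j = C (c i) * g i ^ (n + 1) := fun i => by
      rw [Fin.prod_univ_succ]
      simp only [f, if_true, Fin.succ_ne_zero, if_false, Finset.prod_const, Finset.card_univ,
        Fintype.card_fin]
      ring
    have hsum : ∑ i, C (c i) * g i ^ (n + 1) = ∑ i, ∏ j, f i j :=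
      Finset.sum_congr rfl fun i _ => (hprod i).symm
    rw [hsum]
    exact hab k (n + 1) t f hf

/-- In the weak form, **the hypothesis of KPTT Theorem 3 (sums of powers) is equivalent to that of
Theorem 1 (sums of products)**, up to the constants: `newtonTauWeak ↔` "some bound
`2^{am}(kt+2)^b` on the vertices of `Newt(Σ_{i<k} c_i g_i^m)` for `t`-sparse `g_i`". Both sides
are OPEN statements; the equivalence asserts neither.
[cite: KoiranPortierTavenasThomasse2015, Thm. 3 and its proof (§3; held text p0005:L92–p0006:L8)] -/
theorem newtonTauWeak_iff_powersBound :
    newtonTauWeak ↔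
      ∃ a b : ℕ, ∀ (k m t : ℕ) (c : Fin k → ℂ) (g : Fin k → MvPolynomial (Fin 2) ℂ),
        (∀ i, (g i).support.card ≤ t) →
          newtonVertexCount (∑ i, C (c i) * g i ^ m) ≤ 2 ^ (a * m) * (k * t + 2) ^ b :=
  ⟨powersBound_of_newtonTauWeak, newtonTauWeak_of_powersBound⟩

/-! ### Theorem 3 -/

/-- **KPTT 2015, Theorem 3 (weak-form instance): it suffices to bound the Newton polygons of sums
of powers.** IF for some constants `a, b` every `f = Σ_{i<k} a_i f_i^m` with `a_i ∈ ℂ` and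
`t`-sparse bivariate `f_i` has a Newton polygon with at most `2^{am}(kt+2)^b` vertices (KPTT
Theorem 3's hypothesis — OPEN; nothing here asserts it), then the permanent family `(per_n)` is not
in `VP_ℂ` (not computable by polynomial-size arithmetic circuits). Printed with the hypothesis
`2^{(m + log kt)^c}`, `c < 2`; recorded, as `theorem1`, in the weak-form instance. Proof as
printed: Fischer's formula reduces to Theorem 1 (`newtonTauWeak_of_powersBound`, then the tree's
`theorem1_holds`). [cite: KoiranPortierTavenasThomasse2015, Thm. 3 (§3; held text p0005:L92–L102)] -/
theorem not_isVPFamily_per_of_powersBound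
    (h : ∃ a b : ℕ, ∀ (k m t : ℕ) (c : Fin k → ℂ) (g : Fin k → MvPolynomial (Fin 2) ℂ),
      (∀ i, (g i).support.card ≤ t) →
        newtonVertexCount (∑ i, C (c i) * g i ^ m) ≤ 2 ^ (a * m) * (k * t + 2) ^ b) :
    ¬ IsVPFamily (fun n => perPoly (Fin n) ℂ) :=
  theorem1_holds (newtonTauWeak_of_powersBound h)

/-- **KPTT 2015, Theorem 3, coefficient-free hypothesis** ("we can assume that all the
coefficients `a_i` are equal to 1"): IF `Newt(Σ_{i<k} g_i^m)` has at most `2^{am}(kt+2)^b` vertices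
for all `t`-sparse bivariate `g_i` over `ℂ` (OPEN hypothesis; nothing here asserts it), then
`(per_n)` is not in `VP_ℂ`.
[cite: KoiranPortierTavenasThomasse2015, Thm. 3 and the sentence after it (§3; held text p0005:L92–L106)] -/
theorem not_isVPFamily_per_of_purePowersBound
    (h : ∃ a b : ℕ, ∀ (k m t : ℕ) (g : Fin k → MvPolynomial (Fin 2) ℂ),
      (∀ i, (g i).support.card ≤ t) →
        newtonVertexCount (∑ i, g i ^ m) ≤ 2 ^ (a * m) * (k * t + 2) ^ b) :
    ¬ IsVPFamily (fun n => perPoly (Fin n) ℂ) :=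
  theorem1_holds (newtonTauWeak_of_purePowersBound h)

end KPTT

end Literature.Computability.AlgebraicComplexity
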